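import Summits.AtomisticToContinuum.Crystallization.Theorems.ChargedEnergyGapFiniteReduction
import Summits.AtomisticToContinuum.Crystallization.Theorems.ChargedEnergyGapChargingFrame
import HarnessLib

/-!
# Charged energy gap — lens-3 g65, node «BarlowRef» (R3) — part 24 «BlockCharging»: the bulk far residue CHARGED TO EQUIVARIANT BLOCKS (item 1)

Cell `decomp-a2c`, seat lens-3, generation 65.  Imports the tree's part 17 (`…FiniteReduction`) and part 23 (`…ChargingFrame`).  ELEMENTARY·PROVED.
Part 23's periodic charging frame instantiated on the data of (H𝄪ˢ):
* the LIVE PAIRS are (bulk source, far target): `IsBulkSource y` (`y ∉ X`, `w_C(y) = 1`, no transition, `χ_σ(y) > 0`) and `IsFarTarget z`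
  (`z ∈ X ∖ nearZone`); `bulkPairWeight y z = [y bulk]·χ(y)·[z ≠ y, z far]·d_yz⁻⁶` is `Λ`-invariant (`bulkPairWeight_add`; with the periodicity of
  `transMult` / `aliveFactor` / `InTransition`, complementing P-W's `profileWeight_add…` / `localFactor_add…`);
* the CARRIER BUDGET `chargeBudget B_T B_χ B_H c = B_T·[c ∉ X, 0 < w < 1]·χ(c) + B_χ·[c ∉ X]·w·alive·mult² + B_H·[c ∈ X ∩ nearZone]` is
  `Λ`-periodic and its motif sum IS `B_T·shellMassL + B_χ·transMassL + B_H·pricedNearCountL` (`sum_chargeBudget_eq`);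
* ★★ `bulkFarResidue_le_budget_of_blocks` — a block assignment, equivariant on live pairs of points, inside `P.points`, with rates `Λr` periodic on
  `P.points` and positive on the motif, the harmonic
  criterion `1 ≤ Σ_{c ∈ Blk y z} chargeBudget c / Λr c` per live pair, and the per-motif-carrier load bound `Σ_{p ∈ Q} d_p⁻⁶ ≤ Λr c₀` over finite sets
  `Q` of live pairs of points whose blocks contain `c₀` ⟹ `bulkFarResidue ≤ B_T·shellMassL + B_χ·transMassL + B_H·pricedNearCountL`
  (part 17 `bulkFarResidue_le_of_finite_inv6` + part 23 `motif_pair_sum_le_budget`).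
Part 25 derives the load bound from `TubeShareBoundH` and packages the remaining geometric existence statement (the block EXHIBITION).

0 sorry; standard axioms.
-/

noncomputable section

open scoped Classical

open Literature.MathematicalPhysics.StatisticalMechanics Literature.Geometry.DiscreteGeometry
open Summit.AtomisticToContinuum.Crystallization.Theses.PricedLinkCensus
open Summit.AtomisticToContinuum.Crystallization.Theorems.ChargedEnergyGapNegative

namespace Summit.AtomisticToContinuum.Crystallization.Theorems.ChargedEnergyGapChartDial

section BlockCharging

variable (ϱχ : ℝ) {m : ℕ} (D : Fin m → Set E3) (σ : Fin m → Bool) (P : PeriodicConfiguration 3) (X : Set E3) (ϱ : ℝ) (C : Set E3)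

/-! ### Periodicity of the transition data -/

variable {D P} in
/-- `InTransition` is `Λ`-periodic for invariant listed sets. -/
theorem inTransition_add_iff (hD : ∀ i, IsInvariantSet P (D i)) {g : E3} (hg : g ∈ P.lattice) (i : Fin m) (y : E3) :
    InTransition ϱχ D i (y + g) ↔ InTransition ϱχ D i y := by
  unfold InTransition
  rw [profileWeight_add_of_isInvariantSet ϱχ (hD i) hg]

variable {D P} in
/-- The transition multiplicity is `Λ`-periodic. -/
theorem transMult_add (hD : ∀ i, IsInvariantSet P (D i)) {g : E3} (hg : g ∈ P.lattice) (y : E3) :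
    transMult ϱχ D (y + g) = transMult ϱχ D y := by
  unfold transMult
  exact congrArg Finset.card (Finset.filter_congr fun i _ => inTransition_add_iff ϱχ hD hg i y)

variable {D P} in
/-- The alive indicator is `Λ`-periodic. -/
theorem aliveFactor_add (hD : ∀ i, IsInvariantSet P (D i)) {g : E3} (hg : g ∈ P.lattice) (y : E3) :
    aliveFactor ϱχ D σ (y + g) = aliveFactor ϱχ D σ y := by
  unfold aliveFactor
  have h1 : ∀ i, InTransition ϱχ D i (y + g) ↔ InTransition ϱχ D i y := fun i => inTransition_add_iff ϱχ hD hg i y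
  refine Finset.prod_congr rfl fun i _ => ?_
  simp only [h1, profileWeight_add_of_isInvariantSet ϱχ (hD i) hg]

/-! ### Live pairs and their weight -/

/-- A **BULK SOURCE**: a non-excised site of profile weight exactly `1`, with no listed set in transition, and ALIVE (`χ_σ > 0`, hence `= 1`). -/
def IsBulkSource (y : E3) : Prop :=
  y ∉ X ∧ profileWeight ϱ C y = 1 ∧ transMult ϱχ D y = 0 ∧ 0 < localFactor ϱχ D σ y

/-- A **FAR TARGET**: an excised site outside the near zone (no paying site within `3ϱ/8`). -/
def IsFarTarget (z : E3) : Prop :=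
  z ∈ X \ nearZone ϱχ D σ P X ϱ C

/-- The **BULK PAIR WEIGHT** `[y bulk]·χ_σ(y)·[z ≠ y, z far]·d_yz⁻⁶` — the summand of part 17's finite reduction. -/
def bulkPairWeight (y z : E3) : ℝ :=
  (if y ∉ X ∧ profileWeight ϱ C y = 1 ∧ transMult ϱχ D y = 0 then localFactor ϱχ D σ y else 0) *
    (if z ≠ y ∧ z ∈ X \ nearZone ϱχ D σ P X ϱ C then (dist y z)⁻¹ ^ 6 else 0)

/-- `bulkPairWeight ≥ 0`. [formal bookkeeping] -/
theorem bulkPairWeight_nonneg (y z : E3) : 0 ≤ bulkPairWeight ϱχ D σ P X ϱ C y z := by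
  unfold bulkPairWeight
  refine mul_nonneg ?_ ?_
  · split_ifs
    · exact localFactor_nonneg (ϱχ := ϱχ) (D := D) (σ := σ) y
    · exact le_rfl
  · split_ifs <;> positivity

/-- `bulkPairWeight ≤ d⁻⁶`. -/
theorem bulkPairWeight_le (y z : E3) : bulkPairWeight ϱχ D σ P X ϱ C y z ≤ (dist y z)⁻¹ ^ 6 := by
  unfold bulkPairWeight
  have h6 : 0 ≤ (dist y z)⁻¹ ^ 6 := by positivity
  have hχ0 := localFactor_nonneg (ϱχ := ϱχ) (D := D) (σ := σ) y
  have hχ1 := localFactor_le_one (ϱχ := ϱχ) (D := D) (σ := σ) y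
  split_ifs <;> nlinarith

/-- A pair of positive weight is a live pair, and its weight is `χ(y)·d⁻⁶ ≤ d⁻⁶`. -/
theorem live_of_bulkPairWeight_pos {y z : E3} (h : 0 < bulkPairWeight ϱχ D σ P X ϱ C y z) :
    IsBulkSource ϱχ D σ X ϱ C y ∧ IsFarTarget ϱχ D σ P X ϱ C z ∧ z ≠ y := by
  unfold bulkPairWeight at h
  by_cases h1 : y ∉ X ∧ profileWeight ϱ C y = 1 ∧ transMult ϱχ D y = 0
  · by_cases h2 : z ≠ y ∧ z ∈ X \ nearZone ϱχ D σ P X ϱ C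
    · rw [if_pos h1, if_pos h2] at h
      have hχ : 0 < localFactor ϱχ D σ y := by
        rcases (localFactor_nonneg (ϱχ := ϱχ) (D := D) (σ := σ) y).lt_or_eq with hlt | heq
        · exact hlt
        · rw [← heq, zero_mul] at h
          exact absurd h (lt_irrefl 0)
      exact ⟨⟨h1.1, h1.2.1, h1.2.2, hχ⟩, h2.2, h2.1⟩
    · rw [if_neg h2, mul_zero] at h
      exact absurd h (lt_irrefl 0)
  · rw [if_neg h1, zero_mul] at h
    exact absurd h (lt_irrefl 0)

variable {P X C D} in
/-- ★ The bulk pair weight is `Λ`-INVARIANT for invariant data. -/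
theorem bulkPairWeight_add (hX : IsInvariantSet P X) (hC : IsInvariantSet P C) (hD : ∀ i, IsInvariantSet P (D i)) {g : E3}
    (hg : g ∈ P.lattice) (y z : E3) :
    bulkPairWeight ϱχ D σ P X ϱ C (y + g) (z + g) = bulkPairWeight ϱχ D σ P X ϱ C y z := by
  unfold bulkPairWeight
  have h1 : (y + g ∉ X ∧ profileWeight ϱ C (y + g) = 1 ∧ transMult ϱχ D (y + g) = 0) ↔
      (y ∉ X ∧ profileWeight ϱ C y = 1 ∧ transMult ϱχ D y = 0) := by
    rw [hX g hg y, profileWeight_add_of_isInvariantSet ϱ hC hg, transMult_add ϱχ hD hg]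
  have h2 : (z + g ≠ y + g ∧ z + g ∈ X \ nearZone ϱχ D σ P X ϱ C) ↔ (z ≠ y ∧ z ∈ X \ nearZone ϱχ D σ P X ϱ C) := by
    rw [Ne, add_left_inj, Set.mem_sdiff, Set.mem_sdiff, hX g hg z, (isInvariantSet_nearZone ϱχ σ ϱ hX hC hD) g hg z]
  simp only [h1, h2, localFactor_add_of_isInvariantSet ϱχ hD σ hg, dist_add_right]

/-! ### The carrier budget -/

/-- The **CARRIER BUDGET** `B_T·[c ∉ X, 0 < w_C(c) < 1]·χ_σ(c) + B_χ·[c ∉ X]·w_C(c)·alive_σ(c)·mult(c)² + B_H·[c ∈ X ∩ nearZone]` — the summands of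
`shellMassL`, `transMassL`, `pricedNearCountL`. -/
def chargeBudget (B_T B_χ B_H : ℝ) (c : E3) : ℝ :=
  B_T * (if c ∉ X ∧ 0 < profileWeight ϱ C c ∧ profileWeight ϱ C c < 1 then localFactor ϱχ D σ c else 0) +
    B_χ * (if c ∈ X then 0 else profileWeight ϱ C c * aliveFactor ϱχ D σ c * (transMult ϱχ D c : ℝ) ^ 2) +
    B_H * (if c ∈ X ∩ nearZone ϱχ D σ P X ϱ C then 1 else 0)

/-- The carrier budget is non-negative for non-negative dials. [formal bookkeeping] -/
theorem chargeBudget_nonneg {B_T B_χ B_H : ℝ} (hT : 0 ≤ B_T) (hχ : 0 ≤ B_χ) (hH : 0 ≤ B_H) (c : E3) :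
    0 ≤ chargeBudget ϱχ D σ P X ϱ C B_T B_χ B_H c := by
  unfold chargeBudget
  have h1 : 0 ≤ (if c ∉ X ∧ 0 < profileWeight ϱ C c ∧ profileWeight ϱ C c < 1 then localFactor ϱχ D σ c else 0) := by
    split_ifs
    · exact localFactor_nonneg (ϱχ := ϱχ) (D := D) (σ := σ) c
    · exact le_rfl
  have h2 : 0 ≤ (if c ∈ X then 0 else profileWeight ϱ C c * aliveFactor ϱχ D σ c * (transMult ϱχ D c : ℝ) ^ 2) := by
    split_ifs
    · exact le_rfl
    · exact mul_nonneg (mul_nonneg (profileWeight_nonneg ϱ C c) (aliveFactor_nonneg (ϱχ := ϱχ) (D := D) (σ := σ) c)) (sq_nonneg _)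
  have h3 : 0 ≤ (if c ∈ X ∩ nearZone ϱχ D σ P X ϱ C then (1 : ℝ) else 0) := by
    split_ifs <;> norm_num
  positivity

variable {P X C D} in
/-- ★ The carrier budget is `Λ`-PERIODIC for invariant data. -/
theorem chargeBudget_add (hX : IsInvariantSet P X) (hC : IsInvariantSet P C) (hD : ∀ i, IsInvariantSet P (D i)) (B_T B_χ B_H : ℝ)
    {g : E3} (hg : g ∈ P.lattice) (c : E3) :
    chargeBudget ϱχ D σ P X ϱ C B_T B_χ B_H (c + g) = chargeBudget ϱχ D σ P X ϱ C B_T B_χ B_H c := by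
  unfold chargeBudget
  have h2 : (c + g ∈ X) ↔ (c ∈ X) := hX g hg c
  have h3 : (c + g ∈ X ∩ nearZone ϱχ D σ P X ϱ C) ↔ (c ∈ X ∩ nearZone ϱχ D σ P X ϱ C) := by
    rw [Set.mem_inter_iff, Set.mem_inter_iff, hX g hg c, (isInvariantSet_nearZone ϱχ σ ϱ hX hC hD) g hg c]
  simp only [h2, h3, profileWeight_add_of_isInvariantSet ϱ hC hg, localFactor_add_of_isInvariantSet ϱχ hD σ hg,
    aliveFactor_add ϱχ σ hD hg, transMult_add ϱχ hD hg]

/-- ★ **THE MOTIF SUM OF THE CARRIER BUDGET IS THE RIGHT-HAND SIDE OF THE RESIDUAL**: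
`Σ_{c ∈ motif} chargeBudget c = B_T·shellMassL + B_χ·transMassL + B_H·pricedNearCountL`. -/
theorem sum_chargeBudget_eq (B_T B_χ B_H : ℝ) :
    ∑ c ∈ P.motif, chargeBudget ϱχ D σ P X ϱ C B_T B_χ B_H c =
      B_T * shellMassL ϱχ D σ P X ϱ C + B_χ * transMassL ϱχ D σ P X ϱ C + B_H * (pricedNearCountL ϱχ D σ P X ϱ C : ℝ) := by
  unfold chargeBudget shellMassL transMassL
  rw [Finset.sum_add_distrib, Finset.sum_add_distrib, ← Finset.mul_sum, ← Finset.mul_sum, ← Finset.mul_sum,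
    pricedNearCountL_eq_card, Finset.card_filter]
  push_cast
  rfl

/-! ### The bulk far residue charged to equivariant blocks -/

variable {P X C D} in
/-- ★★ **THE BULK FAR RESIDUE CHARGED TO EQUIVARIANT BLOCKS.**  For invariant data `X, C, Dᵢ`, non-negative dials, an equivariant block
assignment `Blk` inside `P.points` on the live pairs, periodic rates `Λr` positive on the motif, the HARMONIC CRITERION
`1 ≤ Σ_{c ∈ Blk y z} chargeBudget c / Λr c` for every live pair of points, and the LOAD BOUND `Σ_{p ∈ Q} d_p⁻⁶ ≤ Λr c₀` for every motif carrier
`c₀` and every finite set `Q` of live pairs of points whose blocks contain `c₀`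
⟹ `bulkFarResidue ≤ B_T·shellMassL + B_χ·transMassL + B_H·pricedNearCountL`. -/
theorem bulkFarResidue_le_budget_of_blocks {B_T B_χ B_H : ℝ} (hBT : 0 ≤ B_T) (hBχ : 0 ≤ B_χ) (hBH : 0 ≤ B_H)
    (hX : IsInvariantSet P X) (hC : IsInvariantSet P C) (hD : ∀ i, IsInvariantSet P (D i))
    (Blk : E3 → E3 → Finset E3) (Λr : E3 → ℝ)
    (hBlk : ∀ g ∈ P.lattice, ∀ y ∈ P.points, ∀ z ∈ P.points, IsBulkSource ϱχ D σ X ϱ C y → IsFarTarget ϱχ D σ P X ϱ C z → z ≠ y →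
      Blk (y + g) (z + g) = (Blk y z).image (· + g))
    (hΛ : ∀ g ∈ P.lattice, ∀ c ∈ P.points, Λr (c + g) = Λr c) (hΛ0 : ∀ c ∈ P.motif, 0 < Λr c)
    (hsub : ∀ y ∈ P.points, ∀ z ∈ P.points, IsBulkSource ϱχ D σ X ϱ C y → IsFarTarget ϱχ D σ P X ϱ C z → z ≠ y →
      (↑(Blk y z) : Set E3) ⊆ P.points)
    (hharm : ∀ y ∈ P.points, ∀ z ∈ P.points, IsBulkSource ϱχ D σ X ϱ C y → IsFarTarget ϱχ D σ P X ϱ C z → z ≠ y →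
      1 ≤ ∑ c ∈ Blk y z, chargeBudget ϱχ D σ P X ϱ C B_T B_χ B_H c / Λr c)
    (hload : ∀ c₀ ∈ P.motif, ∀ Q : Finset (E3 × E3),
      (∀ p ∈ Q, p.1 ∈ P.points ∧ p.2 ∈ P.points ∧ IsBulkSource ϱχ D σ X ϱ C p.1 ∧ IsFarTarget ϱχ D σ P X ϱ C p.2 ∧ p.2 ≠ p.1 ∧
        c₀ ∈ Blk p.1 p.2) → ∑ p ∈ Q, (dist p.1 p.2)⁻¹ ^ 6 ≤ Λr c₀) :
    bulkFarResidue ϱχ D σ P X ϱ C ≤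
      B_T * shellMassL ϱχ D σ P X ϱ C + B_χ * transMassL ϱχ D σ P X ϱ C + B_H * (pricedNearCountL ϱχ D σ P X ϱ C : ℝ) := by
  refine bulkFarResidue_le_of_finite_inv6 (ϱχ := ϱχ) (D := D) (σ := σ) (P := P) (X := X) (ϱ := ϱ) (C := C) fun G hG => ?_
  have hre : ∀ y ∈ P.motif,
      (if y ∉ X ∧ profileWeight ϱ C y = 1 ∧ transMult ϱχ D y = 0 then localFactor ϱχ D σ y else 0) *
        ∑ z ∈ G, (if z ≠ y ∧ z ∈ X \ nearZone ϱχ D σ P X ϱ C then (dist y z)⁻¹ ^ 6 else 0) =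
      ∑ z ∈ G, bulkPairWeight ϱχ D σ P X ϱ C y z := by
    intro y _
    rw [Finset.mul_sum]
    rfl
  rw [Finset.sum_congr rfl hre, ← sum_chargeBudget_eq]
  refine motif_pair_sum_le_budget P (bulkPairWeight ϱχ D σ P X ϱ C) (chargeBudget ϱχ D σ P X ϱ C B_T B_χ B_H) Λr Blk
    (bulkPairWeight_nonneg ϱχ D σ P X ϱ C) (fun g hg y z => bulkPairWeight_add ϱχ σ ϱ hX hC hD hg y z)
    (chargeBudget_nonneg ϱχ D σ P X ϱ C hBT hBχ hBH) (fun g hg c _ => chargeBudget_add ϱχ σ ϱ hX hC hD B_T B_χ B_H hg c) hΛ hΛ0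
    (fun g hg y hy z hz hw => ?_) (fun y hy z hz hw => ?_) (fun y hy z hz hw => ?_) (fun c₀ hc₀ Q hQ => ?_) G hG
  · obtain ⟨hb, hf, hne⟩ := live_of_bulkPairWeight_pos ϱχ D σ P X ϱ C hw
    exact hBlk g hg y hy z hz hb hf hne
  · obtain ⟨hb, hf, hne⟩ := live_of_bulkPairWeight_pos ϱχ D σ P X ϱ C hw
    exact hsub y hy z hz hb hf hne
  · obtain ⟨hb, hf, hne⟩ := live_of_bulkPairWeight_pos ϱχ D σ P X ϱ C hw
    exact hharm y hy z hz hb hf hne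
  · calc ∑ p ∈ Q, bulkPairWeight ϱχ D σ P X ϱ C p.1 p.2 ≤ ∑ p ∈ Q, (dist p.1 p.2)⁻¹ ^ 6 :=
          Finset.sum_le_sum fun p _ => bulkPairWeight_le ϱχ D σ P X ϱ C p.1 p.2
      _ ≤ Λr c₀ := hload c₀ hc₀ Q fun p hp => by
          obtain ⟨h1, h2, hw, hc⟩ := hQ p hp
          obtain ⟨hb, hf, hne⟩ := live_of_bulkPairWeight_pos ϱχ D σ P X ϱ C hw
          exact ⟨h1, h2, hb, hf, hne, hc⟩

end BlockCharging

end Summit.AtomisticToContinuum.Crystallization.Theorems.ChargedEnergyGapChartDial
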